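import Literature.Topology.FourManifolds.SmoothPoincareLowDim
import HarnessLib

/-!
# spc4.S31 (3-dimensional Poincaré conjecture) in the shapes of Mathlib's `proof_wanted` texts

Proof file (sibling of `SPC4Wave0.lean` and `SPC4Wave0Proofs.lean`) about the named facts
`Literature.Topology.FourManifolds.nonempty_homeomorph_sphere_three` (spc4.S31, topological form:
a closed simply connected Hausdorff second countable topological 3-manifold is homeomorphic to
`S³`) and `Literature.Topology.FourManifolds.nonempty_diffeomorph_sphere_three` (smooth form).
Source: Perelman (arXiv:math/0211159, 0303109, 0307245 — the last, Thm. 1.1 with Remark 1.4,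
gives the "elliptization conjecture": a closed 3-manifold with finite fundamental group is
diffeomorphic to a spherical space form); book form Morgan–Tian, *Ricci flow and the Poincaré
conjecture* (2007), Thm. 0.1 and Cor. 0.2 (a) ("A closed, simply connected 3-manifold is
diffeomorphic to `S³`"), with footnote 1 on p. ix for the passage TOP ↔ DIFF (proved in
`SPC4Wave0Proofs.lean` over spc4.S33).

**Nothing here discharges spc4.S31** — its residual debt is exactly Perelman's theorem in the
smooth category plus Moise's theorem, see `nonempty_homeomorph_sphere_three_of_diffeomorph`
(`SPC4Wave0Proofs.lean`). What IS proved here is that the tree's vendored forms, which add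
`[SecondCountableTopology M]` to Mathlib's binder lists (design choice of `SPC4Wave0.lean`), are
not weaker than the texts of `Mathlib/Geometry/Manifold/PoincareConjecture.lean`:

* `nonempty_homeomorph_sphere_three_iff_of_compactSpace`: the topological form is EQUIVALENT to
  the literal text of Mathlib's `proof_wanted SimplyConnectedSpace.nonempty_homeomorph_sphere_three`
  (binders `[T2Space M] [ChartedSpace ℝ³ M] [SimplyConnectedSpace M] [CompactSpace M]`, no
  countability): a compact space charted on the second countable model `ℝ³` is second countable
  (`ChartedSpace.secondCountable_of_sigmaCompact`).
* `nonempty_diffeomorph_sphere_three_iff_of_compactSpace`: the same for the smooth form and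
  `proof_wanted SimplyConnectedSpace.nonempty_sdiffeomorph_sphere_three`.
* `nonempty_homeomorph_sphere_three_of_homotopyEquiv`: the topological form implies the case
  `n = 3` of the generalised topological Poincaré conjecture in the tree's shape (that of
  spc4.S04 `nonempty_homeomorph_sphere_four` and spc4.S14 `nonempty_homeomorph_sphere_of_five_le`,
  i.e. Mathlib's `proof_wanted ContinuousMap.HomotopyEquiv.nonempty_homeomorph_sphere` with the
  tree's Hausdorff + second countable convention): a 3-manifold homotopy equivalent to `𝕊³` is
  compact (`compactSpace_of_homotopyEquiv_sphere`, Hatcher Prop. 3.29) and simply connected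
  (`π₁(S³) = 1`, Hatcher Prop. 1.14, and homotopy invariance). This is the topological twin of
  `nonemptyDiffeomorphSphere_three_of` (`SmoothPoincareLowDim.lean`).

No definition and no named fact is introduced (D-0026: net debt `0`).

## References

* J. Morgan, G. Tian, *Ricci flow and the Poincaré conjecture*, Clay Math. Monographs 3, AMS/CMI
  (2007), Introduction p. ix (statement and footnote 1), Thm. 0.1, Cor. 0.2 (a);
  arXiv:math/0607607. [MorganTian2007]
* G. Perelman, *Finite extinction time for the solutions to the Ricci flow on certain
  three-manifolds*, arXiv:math/0307245 (2003), Thm. 1.1 and Remark 1.4; with arXiv:math/0211159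
  (2002) and arXiv:math/0303109 (2003). [Perelman2002Entropy]
* A. Hatcher, *Algebraic Topology*, CUP (2002), Prop. 1.14, Prop. 3.29. [HatcherAT2002]
-/

noncomputable section

open scoped Manifold ContDiff
open ContinuousMap

namespace Literature.Topology.FourManifolds

universe u

/-! ### The tree's forms versus Mathlib's literal `proof_wanted` texts -/

/-- **spc4.S31 (topological form) is equivalent to the literal text of Mathlib's
`proof_wanted SimplyConnectedSpace.nonempty_homeomorph_sphere_three`**, whose binders are
`[T2Space M] [ChartedSpace ℝ³ M] [SimplyConnectedSpace M] [CompactSpace M]` without second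
countability: a compact (hence σ-compact) space charted on the second countable model `ℝ³` is
second countable (`ChartedSpace.secondCountable_of_sigmaCompact`), so the extra hypothesis of the
vendored form is automatic; the converse direction just forgets it. (Morgan–Tian 2007, p. ix:
"a closed, smooth, simply connected 3-manifold is diffeomorphic to `S³`", topological reading by
footnote 1.) [cite: MorganTian2007, Introduction p. ix and Cor. 0.2 (a)] -/
theorem nonempty_homeomorph_sphere_three_iff_of_compactSpace :
    nonempty_homeomorph_sphere_three.{u} ↔
      ∀ (M : Type u) [TopologicalSpace M] [T2Space M]
        [ChartedSpace (EuclideanSpace ℝ (Fin 3)) M] [SimplyConnectedSpace M] [CompactSpace M],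
        Nonempty (M ≃ₜ Metric.sphere (0 : EuclideanSpace ℝ (Fin 4)) 1) := by
  constructor
  · intro h M _ _ _ _ _
    haveI : SecondCountableTopology M :=
      ChartedSpace.secondCountable_of_sigmaCompact (EuclideanSpace ℝ (Fin 3)) M
    exact h M
  · intro h M _ _ _ _ _ _
    exact h M

/-- **spc4.S31 (smooth form) is equivalent to the literal text of Mathlib's
`proof_wanted SimplyConnectedSpace.nonempty_sdiffeomorph_sphere_three`** (binders
`[T2Space M] [ChartedSpace ℝ³ M] [IsManifold (𝓡 3) ∞ M] [SimplyConnectedSpace M] [CompactSpace M]`,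
no countability), for the same reason: compact manifolds charted on `ℝ³` are second countable
(`ChartedSpace.secondCountable_of_sigmaCompact`). This is Perelman's theorem as printed by
Morgan–Tian, Cor. 0.2 (a): "A closed, simply connected 3-manifold is diffeomorphic to `S³`."
[cite: MorganTian2007, Cor. 0.2 (a)] -/
theorem nonempty_diffeomorph_sphere_three_iff_of_compactSpace :
    nonempty_diffeomorph_sphere_three.{u} ↔
      ∀ (M : Type u) [TopologicalSpace M] [T2Space M]
        [ChartedSpace (EuclideanSpace ℝ (Fin 3)) M] [IsManifold (𝓡 3) ∞ M]
        [SimplyConnectedSpace M] [CompactSpace M],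
        Nonempty (M ≃ₘ⟮𝓡 3, 𝓡 3⟯ Metric.sphere (0 : EuclideanSpace ℝ (Fin 4)) 1) := by
  constructor
  · intro h M _ _ _ _ _ _
    haveI : SecondCountableTopology M :=
      ChartedSpace.secondCountable_of_sigmaCompact (EuclideanSpace ℝ (Fin 3)) M
    exact h M
  · intro h M _ _ _ _ _ _ _
    exact h M

/-! ### The topological form in the shape of the generalised Poincaré conjecture, `n = 3` -/

/-- **The case `n = 3` of the generalised topological Poincaré conjecture from spc4.S31.**
GIVEN the topological form of spc4.S31 (`nonempty_homeomorph_sphere_three`: Perelman;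
Morgan–Tian 2007, Cor. 0.2 (a) with footnote 1, p. ix), every Hausdorff second countable
topological 3-manifold `M` homotopy equivalent to `𝕊³` is homeomorphic to `𝕊³` — the shape of
spc4.S04 (`nonempty_homeomorph_sphere_four`, Freedman) and spc4.S14
(`nonempty_homeomorph_sphere_of_five_le`, Smale–Newman–Connell), i.e. of Mathlib's
`proof_wanted ContinuousMap.HomotopyEquiv.nonempty_homeomorph_sphere` in the tree's convention:
such an `M` is compact (`compactSpace_of_homotopyEquiv_sphere`: otherwise `H₃(M; ℤ) = 0 ≠ H₃(S³; ℤ)`,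
Hatcher Prop. 3.29) and simply connected (`π₁(S³) = 1`, Hatcher Prop. 1.14,
`simplyConnectedSpace_euclideanSphere`, transported along the homotopy equivalence by Mathlib's
`ContinuousMap.HomotopyEquiv.simplyConnectedSpace`). Topological twin of
`nonemptyDiffeomorphSphere_three_of`. [cite: MorganTian2007, Cor. 0.2 (a) and p. ix fn. 1] [cite: HatcherAT2002, Prop. 1.14, Prop. 3.29] -/
theorem nonempty_homeomorph_sphere_three_of_homotopyEquiv (h : nonempty_homeomorph_sphere_three.{u})
    (M : Type u) [TopologicalSpace M] [T2Space M] [SecondCountableTopology M]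
    [ChartedSpace (EuclideanSpace ℝ (Fin 3)) M]
    (e : M ≃ₕ Metric.sphere (0 : EuclideanSpace ℝ (Fin 4)) 1) :
    Nonempty (M ≃ₜ Metric.sphere (0 : EuclideanSpace ℝ (Fin 4)) 1) := by
  haveI : CompactSpace M := compactSpace_of_homotopyEquiv_sphere (n := 3) (by norm_num) M e
  haveI := simplyConnectedSpace_euclideanSphere (n := 3) (by norm_num)
  haveI : SimplyConnectedSpace M := e.simplyConnectedSpace
  exact h M

end Literature.Topology.FourManifolds

end
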